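import Literature.NumberTheory.Connes2026.ArchimedeanCutoffTraceKernel
import Literature.NumberTheory.ConnesConsani2021.SineIntegralLogAsymptotics
import HarnessLib

/-!
# Connes 1999 Thm V.3 / Letter §7.1, archimedean cutoff trace — ANALYTIC HALF and ASSEMBLY:
# `Σ_i ⟪b_i, ϑ(f) 𝔽 P_Λ 𝔽⁻¹ P_Λ b_i⟫ = 2 g(0) log Λ + ∫′_ℝ + o(1)` (the `P = ∅` instance of
# `Connes1999_thm_VII_4_rat`, PROVED)

LABEL (line 1): RH-FREE literature (theorems only: no definition, no named fact).  bears_on: LADDER-RH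
W-C/W-P (C1), cell `rh-crit`, sub-cell cc, overflow row O1 — green layer under `Connes1999_thm_VII_4_rat`.
WHAT THIS IS NOT: any claim about positivity or RH; nothing here bears on the truth of RH.

Sources.  A. Connes, Selecta Math. 5 (1999) [`Connes1999`], §V Thm 3 (`K = ℝ`), §VII Thm 4, App. II
(36)–(37) (the principal value `∫′`); Connes 2026 Letter [`Connes2026Letter`] §7.1; A. Connes, C. Consani,
Selecta Math. 27 (2021) 77 [`ConnesConsani2021`], §1 Prop. 1.5 (= arXiv Prop. 8) and §2 eq. (25) (the
`Si` closed form of the square integrals).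

## Road

From `ArchimedeanCutoffTraceKernel.tsum_diagCoeff_cutoff_eq_integral` the diagonal series is
`∫ g(τ) e^{−τ/2} D(Λ, e^{−τ}) dτ`, `D(Λ,s) = ∫∫_{[−Λ,Λ]²} cos(2πsxv)cos(2πxv)`.  Part A evaluates the square
integral in closed form `D(Λ,s) = Si(2π(1+s)Λ²)/(π(1+s)) + Si(2π(1−s)Λ²)/(π(1−s))` (`s ≠ 1`); Part B
substitutes `s = e^{−τ}`; Part C lets `Λ → ∞` with the tree's `Si` asymptotics (`Si(T) → π/2`, `|Si| ≤ 5`,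
and `∫₀^T Si(w)/w dw − (π/2)log T → (π/2)γ`, seat t12); Part E records the weight `h(s) = g(−log s)s^{−1/2}`
and Part F the trace formula with its constant in closed real-variable form; Part D (placed after F) identifies
that constant with the tree's `connesArchPV g` (Connes' `∫′_ℝ`, App. II (36)) by an independent `ε → 0⁺`
analysis of (36) (so `lim_{ε→0⁺} connesArchTrunc g ε` is explicit); Part G assembles the hypothesis-free
archimedean trace formula `Connes1999_thm_VII_4_rat_archimedean` (the conclusion of
`Connes1999_thm_VII_4_rat.archimedean` without its hypothesis).
-/

noncomputable section

open _root_.MeasureTheory Complex Set Filter FourierTransform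
open scoped Real Topology ComplexConjugate ENNReal InnerProductSpace Nat

namespace Literature.NumberTheory.Connes2026

open Literature.NumberTheory.LFunctions Literature.NumberTheory.ConnesConsani
  Literature.NumberTheory.ConnesConsani2021 Literature.Analysis.FunctionSpaces

/-! ## Part A. Closed form of the square integral -/

/-- `∫_{−Λ}^{Λ} cos(c x) dx = 2Λ · sinc(cΛ)` (all real `c`; `Λ ≥ 0`). [folklore] -/
private theorem integral_cos_mul_Icc {Λ : ℝ} (hΛ : 0 ≤ Λ) (c : ℝ) :
    ∫ x in Icc (-Λ) Λ, Real.cos (c * x) = 2 * Λ * Real.sinc (c * Λ) := by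
  rw [integral_Icc_eq_integral_Ioc, ← intervalIntegral.integral_of_le (by linarith)]
  rcases eq_or_ne c 0 with rfl | hc
  · simp; ring
  rcases eq_or_ne Λ 0 with rfl | hΛ0
  · simp
  rw [intervalIntegral.integral_comp_mul_left (fun x => Real.cos x) hc, integral_cos,
    Real.sinc_of_ne_zero (mul_ne_zero hc hΛ0), mul_neg, Real.sin_neg, smul_eq_mul]
  field_simp
  ring

/-- Product-to-sum: `∫_{−Λ}^{Λ} cos(2πxy) cos(2πxv) dx = Λ (sinc(2π(y+v)Λ) + sinc(2π(y−v)Λ))`. [cite: ConnesConsani2021, §2 p. 11 ("2cos x cos y = cos(x+y) + cos(x−y)")] -/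
private theorem integral_cos_mul_cos_Icc {Λ : ℝ} (hΛ : 0 ≤ Λ) (y v : ℝ) :
    ∫ x in Icc (-Λ) Λ, Real.cos (2 * π * x * y) * Real.cos (2 * π * x * v) =
      Λ * (Real.sinc (2 * π * (y + v) * Λ) + Real.sinc (2 * π * (y - v) * Λ)) := by
  have h1 : ∀ x : ℝ, Real.cos (2 * π * x * y) * Real.cos (2 * π * x * v) =
      (1 / 2 : ℝ) * Real.cos (2 * π * (y + v) * x) + (1 / 2 : ℝ) * Real.cos (2 * π * (y - v) * x) := by
    intro x
    rw [show 2 * π * (y + v) * x = 2 * π * x * y + 2 * π * x * v by ring,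
      show 2 * π * (y - v) * x = 2 * π * x * y - 2 * π * x * v by ring, Real.cos_add, Real.cos_sub]
    ring
  simp_rw [h1]
  have hi : ∀ c : ℝ, IntegrableOn (fun x => (1 / 2 : ℝ) * Real.cos (c * x)) (Icc (-Λ) Λ) :=
    fun c => Continuous.integrableOn_Icc (by fun_prop)
  rw [integral_add (hi _) (hi _), integral_const_mul, integral_const_mul, integral_cos_mul_Icc hΛ,
    integral_cos_mul_Icc hΛ]
  ring

/-- The sine part is odd: `∫_{−Λ}^{Λ} sin(2πxy) cos(2πxv) dx = 0`. [folklore] -/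
private theorem integral_sin_mul_cos_Icc (Λ y v : ℝ) :
    ∫ x in Icc (-Λ) Λ, Real.sin (2 * π * x * y) * Real.cos (2 * π * x * v) = 0 := by
  rw [← integral_indicator measurableSet_Icc]
  set f : ℝ → ℝ := (Icc (-Λ) Λ).indicator fun x => Real.sin (2 * π * x * y) * Real.cos (2 * π * x * v)
    with hf
  have hneg : (fun x => f (-x)) = fun x => -f x := by
    funext x
    change (Icc (-Λ) Λ).indicator (fun x => Real.sin (2 * π * x * y) * Real.cos (2 * π * x * v)) (-x) =
      -((Icc (-Λ) Λ).indicator (fun x => Real.sin (2 * π * x * y) * Real.cos (2 * π * x * v)) x)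
    have hmem : (-x ∈ Icc (-Λ) Λ) ↔ (x ∈ Icc (-Λ) Λ) := by
      simp only [mem_Icc]; constructor <;> rintro ⟨h1, h2⟩ <;> constructor <;> linarith
    by_cases h : x ∈ Icc (-Λ) Λ
    · rw [indicator_of_mem (hmem.2 h), indicator_of_mem h,
        show 2 * π * -x * y = -(2 * π * x * y) by ring, show 2 * π * -x * v = -(2 * π * x * v) by ring,
        Real.sin_neg, Real.cos_neg]
      ring
    · rw [indicator_of_notMem (fun h' => h (hmem.1 h')), indicator_of_notMem h, neg_zero]
  have h1 : ∫ x, f x = ∫ x, f (-x) := (integral_neg_eq_self f volume).symm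
  rw [hneg, integral_neg] at h1
  linarith

/-- The `x`-integral of the kernel file in real form:
`∫_{−Λ}^{Λ} e^{−2πixy} cos(2πxv) dx = Λ (sinc(2π(y+v)Λ) + sinc(2π(y−v)Λ))`. [folklore] -/
private theorem integral_cexp_mul_cos_Icc {Λ : ℝ} (hΛ : 0 ≤ Λ) (y v : ℝ) :
    ∫ x in Icc (-Λ) Λ, cexp (-(2 * π * x * y * I)) * Complex.cos (2 * π * x * v) =
      ((Λ * (Real.sinc (2 * π * (y + v) * Λ) + Real.sinc (2 * π * (y - v) * Λ)) : ℝ) : ℂ) := by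
  have h1 : ∀ x : ℝ, cexp (-(2 * π * x * y * I)) * Complex.cos (2 * π * x * v) =
      ((Real.cos (2 * π * x * y) * Real.cos (2 * π * x * v) : ℝ) : ℂ) +
        (-I) * ((Real.sin (2 * π * x * y) * Real.cos (2 * π * x * v) : ℝ) : ℂ) := by
    intro x
    rw [show -(2 * π * (x : ℂ) * y * I) = (-(2 * π * x * y) : ℝ) * I by push_cast; ring,
      Complex.exp_mul_I]
    push_cast
    rw [Complex.cos_neg, Complex.sin_neg]
    ring
  simp_rw [h1]
  have hi1 : IntegrableOn (fun x : ℝ => ((Real.cos (2 * π * x * y) * Real.cos (2 * π * x * v) : ℝ) : ℂ))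
      (Icc (-Λ) Λ) := Continuous.integrableOn_Icc (by fun_prop)
  have hi2 : IntegrableOn (fun x : ℝ => (-I) *
      ((Real.sin (2 * π * x * y) * Real.cos (2 * π * x * v) : ℝ) : ℂ)) (Icc (-Λ) Λ) :=
    Continuous.integrableOn_Icc (by fun_prop)
  rw [integral_add hi1 hi2, integral_const_mul, integral_complex_ofReal, integral_complex_ofReal,
    integral_sin_mul_cos_Icc, integral_cos_mul_cos_Icc hΛ]
  simp

/-- `∫_{−Λ}^{Λ} sinc(c Λ v) dv = 2 Si(c Λ²)/(c Λ)` for `cΛ ≠ 0` (`Si′ = sinc`). [cite: ConnesConsani2021, §2 eq. (25) p. 11 (the Si closed form)] -/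
private theorem integral_sinc_Icc {Λ c : ℝ} (hΛ : 0 ≤ Λ) (hc : c * Λ ≠ 0) :
    ∫ v in Icc (-Λ) Λ, Real.sinc (c * Λ * v) = 2 * sinIntegral (c * Λ ^ 2) / (c * Λ) := by
  rw [integral_Icc_eq_integral_Ioc, ← intervalIntegral.integral_of_le (by linarith)]
  have hderiv : ∀ v ∈ Set.uIcc (-Λ) Λ,
      HasDerivAt (fun v => sinIntegral (c * Λ * v) / (c * Λ)) (Real.sinc (c * Λ * v)) v := by
    intro v _
    have h1 := (hasDerivAt_sinIntegral (c * Λ * v)).comp v ((hasDerivAt_id v).const_mul (c * Λ))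
    have h2 := h1.div_const (c * Λ)
    have h3 : Real.sinc (c * Λ * v) * (c * Λ * 1) / (c * Λ) = Real.sinc (c * Λ * v) := by
      rw [mul_one, mul_div_assoc, div_self hc, mul_one]
    exact h2.congr_deriv h3
  rw [intervalIntegral.integral_eq_sub_of_hasDerivAt hderiv
    ((Real.continuous_sinc.comp (by fun_prop)).intervalIntegrable _ _)]
  rw [show c * Λ * -Λ = -(c * Λ ^ 2) by ring, show c * Λ * Λ = c * Λ ^ 2 by ring, sinIntegral_neg]
  ring

/-- **The square integral in closed form** (`s ≠ 1`, `s ≠ −1`, `Λ > 0`):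
`∫_{−Λ}^{Λ}∫_{−Λ}^{Λ} e^{−2πixsv} cos(2πxv) dx dv = Si(2π(s+1)Λ²)/(π(s+1)) + Si(2π(s−1)Λ²)/(π(s−1))`.
[cite: ConnesConsani2021, §1 Prop. 1.5 (ii) (= arXiv Prop. 8) p. 8 and §2 eq. (25) p. 11] -/
theorem integral_sq_cexp_mul_cos_eq_sinIntegral {Λ : ℝ} (hΛ : 0 < Λ) {s : ℝ} (hs1 : s + 1 ≠ 0)
    (hs2 : s - 1 ≠ 0) :
    ∫ v in Icc (-Λ) Λ, ∫ x in Icc (-Λ) Λ, cexp (-(2 * π * x * (s * v) * I)) * Complex.cos (2 * π * x * v) =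
      ((sinIntegral (2 * π * (s + 1) * Λ ^ 2) / (π * (s + 1)) +
        sinIntegral (2 * π * (s - 1) * Λ ^ 2) / (π * (s - 1)) : ℝ) : ℂ) := by
  have h1 : ∀ v : ℝ, ∫ x in Icc (-Λ) Λ, cexp (-(2 * π * x * (s * v) * I)) * Complex.cos (2 * π * x * v) =
      ((Λ * Real.sinc (2 * π * (s + 1) * Λ * v) + Λ * Real.sinc (2 * π * (s - 1) * Λ * v) : ℝ) : ℂ) := by
    intro v
    have := integral_cexp_mul_cos_Icc hΛ.le (s * v) v
    simp only [Complex.ofReal_mul] at this ⊢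
    rw [this]
    push_cast
    rw [show 2 * π * (s * v + v) * Λ = 2 * π * (s + 1) * Λ * v by ring,
      show 2 * π * (s * v - v) * Λ = 2 * π * (s - 1) * Λ * v by ring]
    ring
  simp_rw [h1]
  rw [integral_complex_ofReal]
  have hi : ∀ c : ℝ, IntegrableOn (fun v => Λ * Real.sinc (c * Λ * v)) (Icc (-Λ) Λ) :=
    fun c => Continuous.integrableOn_Icc (by fun_prop)
  rw [integral_add (hi _) (hi _), integral_const_mul, integral_const_mul,
    integral_sinc_Icc hΛ.le (mul_ne_zero (by positivity) hΛ.ne'),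
    integral_sinc_Icc hΛ.le (mul_ne_zero (mul_ne_zero (by positivity) hs2) hΛ.ne')]
  congr 1
  field_simp

/-! ## Part B. The diagonal series as an integral over `s = e^{−τ} ∈ (0,∞)` against the `Si`-kernel -/

/-- Almost every `τ` is non-zero. [folklore] -/
private theorem ae_ne_zero : ∀ᵐ τ : ℝ, τ ≠ 0 := by
  simp [ae_iff]

/-- The range of `τ ↦ e^{−τ}` is `(0, ∞)`. [folklore] -/
private theorem image_exp_neg_univ : (fun τ : ℝ => Real.exp (-τ)) '' univ = Ioi 0 := by
  ext y
  simp only [image_univ, mem_range, mem_Ioi]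
  constructor
  · rintro ⟨τ, rfl⟩; exact Real.exp_pos _
  · intro hy; exact ⟨-Real.log y, by rw [neg_neg, Real.exp_log hy]⟩

/-- **Substitution `s = e^{−τ}`**: `∫_ℝ g(τ) e^{−τ/2} Ψ(e^{−τ}) dτ = ∫₀^∞ g(−log s) s^{−1/2} Ψ(s) ds`.
[cite: ConnesConsani2021, §1 Lemma 1.1 (= arXiv Lemma 4) p. 7 (the isomorphism w, d*λ = dλ/λ)] -/
theorem integral_comp_exp_neg_eq_setIntegral_Ioi (g : ℝ → ℂ) (Ψ : ℝ → ℂ) :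
    ∫ τ, g τ * (Real.exp (-τ / 2) : ℂ) * Ψ (Real.exp (-τ)) =
      ∫ s in Ioi (0 : ℝ), g (-Real.log s) * ((s ^ (-(1 / 2 : ℝ)) : ℝ) : ℂ) * Ψ s := by
  have hderiv : ∀ x ∈ (univ : Set ℝ),
      HasDerivWithinAt (fun τ : ℝ => Real.exp (-τ)) (-Real.exp (-x)) univ x := by
    intro x _
    have h := ((hasDerivAt_id x).neg.exp)
    simp only [mul_neg, mul_one] at h
    exact h.hasDerivWithinAt
  have hinj : InjOn (fun τ : ℝ => Real.exp (-τ)) univ :=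
    fun a _ b _ h => by simpa using Real.exp_injective h
  rw [← image_exp_neg_univ, integral_image_eq_integral_abs_deriv_smul MeasurableSet.univ hderiv hinj,
    setIntegral_univ]
  refine integral_congr_ae (Eventually.of_forall fun τ => ?_)
  simp only [abs_neg, abs_of_pos (Real.exp_pos _), Real.log_exp, neg_neg, Complex.real_smul]
  rw [← Real.exp_mul, show -τ * -(1 / 2 : ℝ) = τ / 2 by ring]
  have h1 : (Real.exp (-τ) : ℂ) * (Real.exp (τ / 2) : ℂ) = (Real.exp (-τ / 2) : ℂ) := by
    rw [← Complex.ofReal_mul, ← Real.exp_add]; congr 1; ring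
  symm
  calc (Real.exp (-τ) : ℂ) * (g τ * (Real.exp (τ / 2) : ℂ) * Ψ (Real.exp (-τ)))
      = g τ * ((Real.exp (-τ) : ℂ) * (Real.exp (τ / 2) : ℂ)) * Ψ (Real.exp (-τ)) := by ring
    _ = g τ * (Real.exp (-τ / 2) : ℂ) * Ψ (Real.exp (-τ)) := by rw [h1]

/-- **The diagonal series against the `Si`-kernel**: for every test function `g`, `Λ > 0` and Hilbert basis `b`
of `L²(ℝ)_ev`,
`Σ_i ⟪b_i, ϑ(f)𝔽P_Λ𝔽⁻¹P_Λ b_i⟫ = ∫₀^∞ g(−log s) s^{−1/2} [Si(2π(s+1)Λ²)/(π(s+1)) + Si(2π(s−1)Λ²)/(π(s−1))] ds`.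
[cite: Connes1999, §V Thm 3 (K = ℝ); ConnesConsani2021, §1 Prop. 1.5 (ii) and §2 eq. (25)] -/
theorem tsum_diagCoeff_cutoff_eq_integral_sinIntegral {g : ℝ → ℂ} (hg : IsWeilTest g) {Λ : ℝ}
    (hΛ : 0 < Λ) {ι : Type*} (b : HilbertBasis ι ℂ evenPart) :
    ∑' i, diagCoeff g (fourierL2 * cutoffProj Λ * fourierL2Inv * cutoffProj Λ)
        ((b i : evenPart) : Lp ℂ 2 (volume : Measure ℝ)) =
      ∫ s in Ioi (0 : ℝ), g (-Real.log s) * ((s ^ (-(1 / 2 : ℝ)) : ℝ) : ℂ) *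
        ((sinIntegral (2 * π * (s + 1) * Λ ^ 2) / (π * (s + 1)) +
          sinIntegral (2 * π * (s - 1) * Λ ^ 2) / (π * (s - 1)) : ℝ) : ℂ) := by
  rw [tsum_diagCoeff_cutoff_eq_integral hg hΛ b,
    ← integral_comp_exp_neg_eq_setIntegral_Ioi g (fun s => ((sinIntegral (2 * π * (s + 1) * Λ ^ 2) /
      (π * (s + 1)) + sinIntegral (2 * π * (s - 1) * Λ ^ 2) / (π * (s - 1)) : ℝ) : ℂ))]
  refine integral_congr_ae ?_
  filter_upwards [ae_ne_zero] with τ hτ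
  have hs1 : Real.exp (-τ) + 1 ≠ 0 := by positivity
  have hs2 : Real.exp (-τ) - 1 ≠ 0 := by
    intro h
    have : Real.exp (-τ) = 1 := by linarith
    rw [Real.exp_eq_one_iff] at this
    exact hτ (by linarith)
  rw [integral_const_mul, integral_sq_cexp_mul_cos_eq_sinIntegral hΛ hs1 hs2]
  ring

/-! ## Part C. `Λ → ∞`: the `Si`-kernels against an integrable weight -/

/-- `|Si(x)/(π a)| ≤ 5/(π|a|)`. [folklore] -/
private theorem abs_sinIntegral_div_le (x a : ℝ) : |sinIntegral x / (π * a)| ≤ 5 / (π * |a|) := by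
  rcases eq_or_ne a 0 with rfl | ha
  · simp
  rw [abs_div, abs_mul, abs_of_pos Real.pi_pos]
  exact div_le_div_of_nonneg_right (abs_sinIntegral_le_five x) (by positivity)

/-- `|Si(c a)/(π a)| ≤ |c|/π` (from `|Si(y)/y| ≤ 1`). [folklore] -/
private theorem abs_sinIntegral_mul_div_le (c a : ℝ) : |sinIntegral (c * a) / (π * a)| ≤ |c| / π := by
  rcases eq_or_ne a 0 with rfl | ha
  · simp; positivity
  rcases eq_or_ne c 0 with rfl | hc
  · simp [sinIntegral_zero]
  have h1 := abs_sinIntegral_div_self_le (c * a)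
  have h2 : sinIntegral (c * a) / (π * a) = (sinIntegral (c * a) / (c * a)) * (c / π) := by
    field_simp
  rw [h2, abs_mul, abs_div c π, abs_of_pos Real.pi_pos]
  calc |sinIntegral (c * a) / (c * a)| * (|c| / π) ≤ 1 * (|c| / π) := by gcongr
    _ = |c| / π := one_mul _

/-- **First kernel**: `∫₀^∞ h(s) Si(2π(s+1)L)/(π(s+1)) ds → ∫₀^∞ h(s)/(2(s+1)) ds` (`L → ∞`; dominated by
`(5/π)|h|`, pointwise `Si → π/2`). [cite: Connes1999, §V Thm 3 (proof, Λ → ∞); ConnesConsani2021, §2 eq. (25)] -/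
theorem tendsto_integral_sinIntegral_kernel_add {h : ℝ → ℂ} (hh : IntegrableOn h (Ioi 0)) :
    Tendsto (fun L : ℝ => ∫ s in Ioi (0 : ℝ), h s *
        ((sinIntegral (2 * π * (s + 1) * L) / (π * (s + 1)) : ℝ) : ℂ)) atTop
      (𝓝 (∫ s in Ioi (0 : ℝ), h s * ((1 / (2 * (s + 1)) : ℝ) : ℂ))) := by
  refine tendsto_integral_filter_of_dominated_convergence (fun s => 5 / π * ‖h s‖) ?_ ?_ ?_ ?_
  · refine Eventually.of_forall fun L => hh.aestronglyMeasurable.mul ?_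
    refine (Complex.measurable_ofReal.comp ?_).aestronglyMeasurable
    exact (continuous_sinIntegral.measurable.comp (by fun_prop)).div (by fun_prop)
  · refine Eventually.of_forall fun L => (ae_restrict_mem measurableSet_Ioi).mono fun s hs => ?_
    rw [norm_mul, Complex.norm_real, Real.norm_eq_abs, mul_comm]
    refine mul_le_mul_of_nonneg_right ?_ (norm_nonneg _)
    have h1 := abs_sinIntegral_div_le (2 * π * (s + 1) * L) (s + 1)
    rw [abs_of_pos (by linarith [mem_Ioi.1 hs] : (0:ℝ) < s + 1)] at h1
    refine h1.trans ?_
    have : (0:ℝ) < s := hs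
    exact div_le_div_of_nonneg_left (by norm_num) Real.pi_pos (by nlinarith [Real.pi_pos])
  · exact (hh.norm.const_mul _)
  · refine (ae_restrict_mem measurableSet_Ioi).mono fun s hs => ?_
    have hs' : (0 : ℝ) < s + 1 := by linarith [mem_Ioi.1 hs]
    have h1 : Tendsto (fun L : ℝ => 2 * π * (s + 1) * L) atTop atTop :=
      tendsto_id.const_mul_atTop (by positivity)
    have h2 : Tendsto (fun L : ℝ => sinIntegral (2 * π * (s + 1) * L) / (π * (s + 1))) atTop
        (𝓝 (π / 2 / (π * (s + 1)))) := (tendsto_sinIntegral_atTop.comp h1).div_const _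
    have h3 : π / 2 / (π * (s + 1)) = 1 / (2 * (s + 1)) := by
      field_simp
    rw [h3] at h2
    exact ((Complex.continuous_ofReal.tendsto _).comp h2).const_mul _

/-- **Second kernel, regular part**: for `k` with `k(s)/|s−1|` integrable on `(0,∞)`,
`∫₀^∞ k(s) Si(2π(s−1)L)/(π(s−1)) ds → ∫₀^∞ k(s)/(2|s−1|) ds` (dominated by `(5/π)|k|/|s−1|`; pointwise
`Si(±∞) = ±π/2`). [cite: Connes1999, §V Thm 3 (proof, Λ → ∞); ConnesConsani2021, §2 eq. (25)] -/
theorem tendsto_integral_sinIntegral_kernel_sub {k : ℝ → ℂ}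
    (hk : IntegrableOn (fun s => k s * ((|s - 1|⁻¹ : ℝ) : ℂ)) (Ioi 0))
    (hkm : AEStronglyMeasurable k (volume.restrict (Ioi 0))) :
    Tendsto (fun L : ℝ => ∫ s in Ioi (0 : ℝ), k s *
        ((sinIntegral (2 * π * (s - 1) * L) / (π * (s - 1)) : ℝ) : ℂ)) atTop
      (𝓝 (∫ s in Ioi (0 : ℝ), k s * (((2 * |s - 1|)⁻¹ : ℝ) : ℂ))) := by
  refine tendsto_integral_filter_of_dominated_convergence
    (fun s => 5 / π * ‖k s * ((|s - 1|⁻¹ : ℝ) : ℂ)‖) ?_ ?_ ?_ ?_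
  · refine Eventually.of_forall fun L => hkm.mul ?_
    refine (Complex.measurable_ofReal.comp ?_).aestronglyMeasurable
    exact (continuous_sinIntegral.measurable.comp (by fun_prop)).div (by fun_prop)
  · refine Eventually.of_forall fun L => Eventually.of_forall fun s => ?_
    rw [norm_mul, norm_mul, Complex.norm_real, Complex.norm_real, Real.norm_eq_abs, Real.norm_eq_abs]
    have h1 := abs_sinIntegral_div_le (2 * π * (s - 1) * L) (s - 1)
    have h2 : |sinIntegral (2 * π * (s - 1) * L) / (π * (s - 1))| ≤ 5 / π * |(|s - 1|⁻¹ : ℝ)| := by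
      refine h1.trans (le_of_eq ?_)
      rw [abs_of_nonneg (by positivity : (0:ℝ) ≤ |s - 1|⁻¹)]
      field_simp
    calc ‖k s‖ * |sinIntegral (2 * π * (s - 1) * L) / (π * (s - 1))|
        ≤ ‖k s‖ * (5 / π * |(|s - 1|⁻¹ : ℝ)|) := mul_le_mul_of_nonneg_left h2 (norm_nonneg (k s))
      _ = 5 / π * (‖k s‖ * |(|s - 1|⁻¹ : ℝ)|) := by ring
  · exact hk.norm.const_mul _
  · have hne : ∀ᵐ s ∂(volume.restrict (Ioi (0:ℝ))), s ≠ 1 := by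
      refine ae_restrict_of_ae ?_
      simp [ae_iff]
    filter_upwards [hne] with s hs
    have key : Tendsto (fun L : ℝ => sinIntegral (2 * π * (s - 1) * L) / (π * (s - 1))) atTop
        (𝓝 ((2 * |s - 1|)⁻¹)) := by
      rcases lt_or_gt_of_ne hs with hlt | hgt
      · have hneg : s - 1 < 0 := by linarith
        have h1 : Tendsto (fun L : ℝ => 2 * π * (s - 1) * L) atTop atBot := by
          have : Tendsto (fun L : ℝ => (2 * π * (1 - s)) * L) atTop atTop :=
            tendsto_id.const_mul_atTop (by nlinarith [Real.pi_pos])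
          refine (tendsto_neg_atTop_atBot.comp this).congr fun L => ?_
          simp only [Function.comp_apply]; ring
        have h2 := (tendsto_sinIntegral_atBot.comp h1).div_const (π * (s - 1))
        have h3 : -(π / 2) / (π * (s - 1)) = (2 * |s - 1|)⁻¹ := by
          rw [abs_of_neg hneg]; field_simp
        rw [h3] at h2; exact h2
      · have hpos : 0 < s - 1 := by linarith
        have h1 : Tendsto (fun L : ℝ => 2 * π * (s - 1) * L) atTop atTop :=
          tendsto_id.const_mul_atTop (by positivity)
        have h2 := (tendsto_sinIntegral_atTop.comp h1).div_const (π * (s - 1))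
        have h3 : π / 2 / (π * (s - 1)) = (2 * |s - 1|)⁻¹ := by
          rw [abs_of_pos hpos]; field_simp
        rw [h3] at h2; exact h2
    exact ((Complex.continuous_ofReal.tendsto _).comp key).const_mul _

/-- `t ↦ Si(t)/t` is interval integrable (bounded by `1`, measurable). [folklore] -/
private theorem intervalIntegrable_sinIntegral_div_self (a b : ℝ) :
    IntervalIntegrable (fun t : ℝ => sinIntegral t / t) volume a b := by
  rw [intervalIntegrable_iff']
  refine Measure.integrableOn_of_bounded (M := 1) isCompact_uIcc.measure_lt_top.ne
    ((continuous_sinIntegral.measurable.div measurable_id).aestronglyMeasurable) ?_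
  exact Eventually.of_forall fun t => by
    rw [Real.norm_eq_abs]; exact abs_sinIntegral_div_self_le t

/-- **The singular part of the second kernel in closed form**:
`∫₀² Si(2π(s−1)L)/(π(s−1)) ds = (2/π) ∫₀^{2πL} Si(t)/t dt` (`L > 0`; substitution `t = 2πL(s−1)`,
evenness of `Si(t)/t`). [cite: ConnesConsani2021, §2 eq. (25) p. 11] -/
theorem integral_sinIntegral_kernel_Ioc_two {L : ℝ} (hL : 0 < L) :
    ∫ s in Ioc (0 : ℝ) 2, sinIntegral (2 * π * (s - 1) * L) / (π * (s - 1)) =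
      2 / π * ∫ t in (0 : ℝ)..(2 * π * L), sinIntegral t / t := by
  set c : ℝ := 2 * π * L with hc
  have hc0 : c ≠ 0 := by positivity
  rw [← intervalIntegral.integral_of_le (by norm_num : (0:ℝ) ≤ 2)]
  have h1 : (fun s : ℝ => sinIntegral (2 * π * (s - 1) * L) / (π * (s - 1))) =
      fun s => (fun u : ℝ => sinIntegral (c * u) / (π * u)) (s - 1) := by
    funext s; simp only [hc]; ring_nf
  rw [h1, intervalIntegral.integral_comp_sub_right (fun u : ℝ => sinIntegral (c * u) / (π * u)) 1]
  norm_num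
  have h2 : (fun u : ℝ => sinIntegral (c * u) / (π * u)) =
      fun u => (fun t : ℝ => c * (sinIntegral t / (π * t))) (c * u) := by
    funext u
    simp only
    rcases eq_or_ne u 0 with rfl | hu
    · simp
    · field_simp
  rw [h2, intervalIntegral.integral_comp_mul_left (fun t : ℝ => c * (sinIntegral t / (π * t))) hc0,
    intervalIntegral.integral_const_mul, smul_eq_mul, ← mul_assoc, inv_mul_cancel₀ hc0, one_mul, mul_neg,
    mul_one]
  have h3 : (fun t : ℝ => sinIntegral t / (π * t)) = fun t => π⁻¹ * (sinIntegral t / t) := by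
    funext t; rw [mul_comm π, ← div_div]; ring
  rw [h3, intervalIntegral.integral_const_mul]
  have hii := fun a b => (intervalIntegrable_sinIntegral_div_self a b)
  rw [← intervalIntegral.integral_add_adjacent_intervals (hii (-c) 0) (hii 0 c)]
  have h4 : ∫ t in (-c)..0, sinIntegral t / t = ∫ t in (0:ℝ)..c, sinIntegral t / t := by
    rw [← neg_zero, ← intervalIntegral.integral_comp_neg]
    simp only [neg_zero, sinIntegral_neg, neg_div_neg_eq]
  rw [h4]
  ring

/-- **The logarithm and the constant `log 2π + γ`**:
`∫₀² Si(2π(s−1)L)/(π(s−1)) ds − log L → log(2π) + γ` (`L → ∞`), from the tree's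
`∫₀^T Si(w)/w dw − (π/2) log T → (π/2)γ` at `T = 2πL`. [cite: ConnesConsani2021, §5.2/App. B (the constant log 4π + γ); Connes1999, App. II (36)–(37) (λ = log 2π + γ)] -/
theorem tendsto_integral_sinIntegral_kernel_Ioc_two_sub_log :
    Tendsto (fun L : ℝ => (∫ s in Ioc (0 : ℝ) 2, sinIntegral (2 * π * (s - 1) * L) / (π * (s - 1))) -
        Real.log L) atTop (𝓝 (Real.log (2 * π) + Real.eulerMascheroniConstant)) := by
  have hT : Tendsto (fun L : ℝ => 2 * π * L) atTop atTop := tendsto_id.const_mul_atTop (by positivity)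
  have h1 := tendsto_integral_sinIntegral_div_sub_log.comp hT
  have h2 : Tendsto (fun L : ℝ => 2 / π * (((fun T ↦ (∫ w in (0 : ℝ)..T, sinIntegral w / w) -
      π / 2 * Real.log T) ∘ fun L : ℝ => 2 * π * L) L) + Real.log (2 * π)) atTop
      (𝓝 (2 / π * (π / 2 * Real.eulerMascheroniConstant) + Real.log (2 * π))) :=
    (h1.const_mul _).add_const _
  have h3 : 2 / π * (π / 2 * Real.eulerMascheroniConstant) + Real.log (2 * π) =
      Real.log (2 * π) + Real.eulerMascheroniConstant := by
    field_simp; ring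
  rw [h3] at h2
  refine h2.congr' ?_
  filter_upwards [eventually_gt_atTop 0] with L hL
  simp only [Function.comp_apply]
  rw [integral_sinIntegral_kernel_Ioc_two hL, Real.log_mul (by positivity) hL.ne']
  field_simp
  ring

/-- **The `Si`-kernel against an integrable weight, `L → ∞`**: for `h` integrable on `(0,∞)` with
`(h(s) − h(1)·1_{s≤2})/|s−1|` integrable there,
`∫₀^∞ h(s)[Si(2π(s+1)L)/(π(s+1)) + Si(2π(s−1)L)/(π(s−1))] ds − h(1) log L
   → ∫₀^∞ h/(2(s+1)) + ∫₀^∞ (h − h(1)1_{s≤2})/(2|s−1|) + h(1)(log 2π + γ)`.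
[cite: Connes1999, §V Thm 3 (K = ℝ, proof: Λ → ∞) and App. II (36)–(37); ConnesConsani2021, §1 Prop. 1.5 (iii), §2 eq. (25)] -/
theorem tendsto_integral_sinIntegral_kernels_sub_log {h : ℝ → ℂ} (hh : IntegrableOn h (Ioi 0))
    (hh2 : IntegrableOn (fun s => (h s - (Iic (2:ℝ)).indicator (fun _ => h 1) s) * ((|s - 1|⁻¹ : ℝ) : ℂ))
      (Ioi 0)) :
    Tendsto (fun L : ℝ => (∫ s in Ioi (0 : ℝ), h s *
        ((sinIntegral (2 * π * (s + 1) * L) / (π * (s + 1)) +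
          sinIntegral (2 * π * (s - 1) * L) / (π * (s - 1)) : ℝ) : ℂ)) - h 1 * (Real.log L : ℂ)) atTop
      (𝓝 ((∫ s in Ioi (0 : ℝ), h s * ((1 / (2 * (s + 1)) : ℝ) : ℂ)) +
        (∫ s in Ioi (0 : ℝ), (h s - (Iic (2:ℝ)).indicator (fun _ => h 1) s) *
          (((2 * |s - 1|)⁻¹ : ℝ) : ℂ)) +
        h 1 * ((Real.log (2 * π) + Real.eulerMascheroniConstant : ℝ) : ℂ))) := by
  set ind : ℝ → ℂ := (Iic (2:ℝ)).indicator (fun _ => h 1) with hind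
  -- integrability of the pieces
  have hind_int : IntegrableOn ind (Ioi 0) := by
    rw [hind, IntegrableOn, integrable_indicator_iff measurableSet_Iic]
    refine integrableOn_const ?_
    rw [Measure.restrict_apply measurableSet_Iic, Iic_inter_Ioi, Real.volume_Ioc]
    exact ENNReal.ofReal_ne_top
  have hk_int : IntegrableOn (fun s => h s - ind s) (Ioi 0) := hh.sub hind_int
  have hKp_meas : ∀ L : ℝ, AEStronglyMeasurable (fun s : ℝ =>
      ((sinIntegral (2 * π * (s + 1) * L) / (π * (s + 1)) : ℝ) : ℂ)) (volume.restrict (Ioi 0)) :=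
    fun L => (Complex.measurable_ofReal.comp ((continuous_sinIntegral.measurable.comp
      (by fun_prop)).div (by fun_prop))).aestronglyMeasurable
  have hKm_meas : ∀ L : ℝ, AEStronglyMeasurable (fun s : ℝ =>
      ((sinIntegral (2 * π * (s - 1) * L) / (π * (s - 1)) : ℝ) : ℂ)) (volume.restrict (Ioi 0)) :=
    fun L => (Complex.measurable_ofReal.comp ((continuous_sinIntegral.measurable.comp
      (by fun_prop)).div (by fun_prop))).aestronglyMeasurable
  have hKp_bdd : ∀ L : ℝ, ∀ᵐ s ∂(volume.restrict (Ioi (0:ℝ))),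
      ‖((sinIntegral (2 * π * (s + 1) * L) / (π * (s + 1)) : ℝ) : ℂ)‖ ≤ 5 / π := by
    intro L
    refine (ae_restrict_mem measurableSet_Ioi).mono fun s hs => ?_
    rw [Complex.norm_real, Real.norm_eq_abs]
    have h1 := abs_sinIntegral_div_le (2 * π * (s + 1) * L) (s + 1)
    rw [abs_of_pos (by linarith [mem_Ioi.1 hs] : (0:ℝ) < s + 1)] at h1
    refine h1.trans ?_
    have : (0:ℝ) < s := hs
    exact div_le_div_of_nonneg_left (by norm_num) Real.pi_pos (by nlinarith [Real.pi_pos])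
  have hKm_bdd : ∀ L : ℝ, ∀ᵐ s ∂(volume.restrict (Ioi (0:ℝ))),
      ‖((sinIntegral (2 * π * (s - 1) * L) / (π * (s - 1)) : ℝ) : ℂ)‖ ≤ |2 * π * L| / π := by
    intro L
    refine Eventually.of_forall fun s => ?_
    rw [Complex.norm_real, Real.norm_eq_abs, show 2 * π * (s - 1) * L = (2 * π * L) * (s - 1) by ring]
    exact abs_sinIntegral_mul_div_le _ _
  have I1 : ∀ L, Integrable (fun s => h s *
      ((sinIntegral (2 * π * (s + 1) * L) / (π * (s + 1)) : ℝ) : ℂ)) (volume.restrict (Ioi 0)) := by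
    intro L
    have := (hh.bdd_mul (hKp_meas L) (hKp_bdd L))
    simpa only [mul_comm] using this
  have I2 : ∀ L, Integrable (fun s => (h s - ind s) *
      ((sinIntegral (2 * π * (s - 1) * L) / (π * (s - 1)) : ℝ) : ℂ)) (volume.restrict (Ioi 0)) := by
    intro L
    have := (hk_int.bdd_mul (hKm_meas L) (hKm_bdd L))
    simpa only [mul_comm] using this
  have I3 : ∀ L, Integrable (fun s => ind s *
      ((sinIntegral (2 * π * (s - 1) * L) / (π * (s - 1)) : ℝ) : ℂ)) (volume.restrict (Ioi 0)) := by
    intro L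
    have := (hind_int.bdd_mul (hKm_meas L) (hKm_bdd L))
    simpa only [mul_comm] using this
  -- the singular piece in closed form
  have hI3 : ∀ L : ℝ, ∫ s in Ioi (0:ℝ), ind s *
      ((sinIntegral (2 * π * (s - 1) * L) / (π * (s - 1)) : ℝ) : ℂ) =
      h 1 * ((∫ s in Ioc (0 : ℝ) 2, sinIntegral (2 * π * (s - 1) * L) / (π * (s - 1)) : ℝ) : ℂ) := by
    intro L
    have h1 : (fun s => ind s * ((sinIntegral (2 * π * (s - 1) * L) / (π * (s - 1)) : ℝ) : ℂ)) =
        (Iic (2:ℝ)).indicator (fun s => h 1 *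
          ((sinIntegral (2 * π * (s - 1) * L) / (π * (s - 1)) : ℝ) : ℂ)) := by
      funext s
      rw [hind]
      by_cases hs : s ∈ Iic (2:ℝ)
      · rw [indicator_of_mem hs, indicator_of_mem hs]
      · rw [indicator_of_notMem hs, indicator_of_notMem hs, zero_mul]
    rw [h1, setIntegral_indicator measurableSet_Iic, Ioi_inter_Iic, integral_const_mul,
      integral_complex_ofReal]
  -- decomposition of the total
  have hdec : ∀ L : ℝ, (∫ s in Ioi (0 : ℝ), h s *
        ((sinIntegral (2 * π * (s + 1) * L) / (π * (s + 1)) +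
          sinIntegral (2 * π * (s - 1) * L) / (π * (s - 1)) : ℝ) : ℂ)) - h 1 * (Real.log L : ℂ) =
      (∫ s in Ioi (0 : ℝ), h s * ((sinIntegral (2 * π * (s + 1) * L) / (π * (s + 1)) : ℝ) : ℂ)) +
      (∫ s in Ioi (0 : ℝ), (h s - ind s) *
        ((sinIntegral (2 * π * (s - 1) * L) / (π * (s - 1)) : ℝ) : ℂ)) +
      h 1 * (((∫ s in Ioc (0 : ℝ) 2, sinIntegral (2 * π * (s - 1) * L) / (π * (s - 1))) -
        Real.log L : ℝ) : ℂ) := by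
    intro L
    have hsplit : (fun s => h s * ((sinIntegral (2 * π * (s + 1) * L) / (π * (s + 1)) +
          sinIntegral (2 * π * (s - 1) * L) / (π * (s - 1)) : ℝ) : ℂ)) =
        fun s => h s * ((sinIntegral (2 * π * (s + 1) * L) / (π * (s + 1)) : ℝ) : ℂ) +
          ((h s - ind s) * ((sinIntegral (2 * π * (s - 1) * L) / (π * (s - 1)) : ℝ) : ℂ) +
            ind s * ((sinIntegral (2 * π * (s - 1) * L) / (π * (s - 1)) : ℝ) : ℂ)) := by
      funext s; push_cast; ring
    have I23 : Integrable (fun s => (h s - ind s) *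
        ((sinIntegral (2 * π * (s - 1) * L) / (π * (s - 1)) : ℝ) : ℂ) +
          ind s * ((sinIntegral (2 * π * (s - 1) * L) / (π * (s - 1)) : ℝ) : ℂ))
        (volume.restrict (Ioi 0)) := (I2 L).add (I3 L)
    rw [hsplit, integral_add (I1 L) I23, integral_add (I2 L) (I3 L), hI3 L]
    push_cast
    ring
  simp_rw [hdec]
  refine ((tendsto_integral_sinIntegral_kernel_add hh).add
    (tendsto_integral_sinIntegral_kernel_sub hh2 hk_int.aestronglyMeasurable)).add ?_
  refine Tendsto.const_mul _ ?_
  exact (Complex.continuous_ofReal.tendsto _).comp tendsto_integral_sinIntegral_kernel_Ioc_two_sub_log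

/-! ## Part E. The weight `h(s) = g(−log s) s^{−1/2}` of a test function -/

/-- A test function is supported in some `[−R, R]`. [folklore] -/
private theorem exists_tsupport_subset_Icc {g : ℝ → ℂ} (hg : IsWeilTest g) :
    ∃ R : ℝ, 0 < R ∧ tsupport g ⊆ Icc (-R) R := by
  obtain ⟨r, hr⟩ := (Metric.isBounded_iff_subset_closedBall (0:ℝ)).1 hg.2.isCompact.isBounded
  refine ⟨max r 1, by positivity, hr.trans ?_⟩
  intro x hx
  rw [Metric.mem_closedBall, Real.dist_eq, sub_zero] at hx
  have := le_max_left r 1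
  constructor <;> [linarith [neg_abs_le x]; linarith [le_abs_self x]]

/-- The weight vanishes off `[e^{−R}, e^{R}]` on `(0,∞)`. [folklore] -/
private theorem weight_eq_zero_of_notMem {g : ℝ → ℂ} {R : ℝ} (hR : tsupport g ⊆ Icc (-R) R) {s : ℝ}
    (hs : 0 < s) (hs' : s ∉ Icc (Real.exp (-R)) (Real.exp R)) :
    g (-Real.log s) * ((s ^ (-(1 / 2 : ℝ)) : ℝ) : ℂ) = 0 := by
  have : g (-Real.log s) = 0 := by
    refine image_eq_zero_of_notMem_tsupport fun hmem => hs' ⟨?_, ?_⟩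
    · have h1 : -R ≤ Real.log s := by linarith [(hR hmem).2]
      rw [← Real.exp_log hs]
      exact Real.exp_le_exp.2 h1
    · have h2 : Real.log s ≤ R := by linarith [(hR hmem).1]
      rw [← Real.exp_log hs]
      exact Real.exp_le_exp.2 h2
  rw [this, zero_mul]

/-- The weight is `C¹` (indeed smooth) on `(0,∞)`. [folklore] -/
private theorem contDiffOn_weight {g : ℝ → ℂ} (hg : IsWeilTest g) :
    ContDiffOn ℝ 1 (fun s : ℝ => g (-Real.log s) * ((s ^ (-(1 / 2 : ℝ)) : ℝ) : ℂ)) (Ioi 0) := by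
  have h1 : ContDiffOn ℝ 1 (fun s : ℝ => -Real.log s) (Ioi 0) :=
    (Real.contDiffOn_log.mono fun x hx => ne_of_gt hx).neg
  have h2 : ContDiffOn ℝ 1 (fun s : ℝ => g (-Real.log s)) (Ioi 0) :=
    (hg.1.of_le (by simp)).comp_contDiffOn h1
  have h3 : ContDiffOn ℝ 1 (fun s : ℝ => ((s ^ (-(1 / 2 : ℝ)) : ℝ) : ℂ)) (Ioi 0) := by
    refine Complex.ofRealCLM.contDiff.comp_contDiffOn ?_
    exact fun x hx => (Real.contDiffAt_rpow_const_of_ne (ne_of_gt hx)).contDiffWithinAt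
  exact h2.mul h3

/-- The weight is continuous on `(0,∞)`. [folklore] -/
private theorem continuousOn_weight {g : ℝ → ℂ} (hg : IsWeilTest g) :
    ContinuousOn (fun s : ℝ => g (-Real.log s) * ((s ^ (-(1 / 2 : ℝ)) : ℝ) : ℂ)) (Ioi 0) :=
  (contDiffOn_weight hg).continuousOn

/-- **(H1)** the weight is integrable on `(0,∞)`. [folklore] -/
private theorem integrableOn_weight {g : ℝ → ℂ} (hg : IsWeilTest g) :
    IntegrableOn (fun s : ℝ => g (-Real.log s) * ((s ^ (-(1 / 2 : ℝ)) : ℝ) : ℂ)) (Ioi 0) := by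
  obtain ⟨R, hR0, hR⟩ := exists_tsupport_subset_Icc hg
  have hsub : Icc (Real.exp (-R)) (Real.exp R) ⊆ Ioi 0 := fun s hs => (Real.exp_pos _).trans_le hs.1
  have h1 : IntegrableOn (fun s : ℝ => g (-Real.log s) * ((s ^ (-(1 / 2 : ℝ)) : ℝ) : ℂ))
      (Icc (Real.exp (-R)) (Real.exp R)) :=
    ((continuousOn_weight hg).mono hsub).integrableOn_Icc
  exact h1.of_forall_sdiff_eq_zero measurableSet_Ioi fun s hs => weight_eq_zero_of_notMem hR hs.1 hs.2

/-- **(H2)** `(h(s) − h(1)·1_{s≤2})/|s−1|` is integrable on `(0,∞)` for the weight `h` of a test function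
(Lipschitz at `s = 1`, bounded support). [folklore] -/
private theorem integrableOn_weight_sub_div {g : ℝ → ℂ} (hg : IsWeilTest g) :
    IntegrableOn (fun s : ℝ => (g (-Real.log s) * ((s ^ (-(1 / 2 : ℝ)) : ℝ) : ℂ) -
      (Iic (2:ℝ)).indicator (fun _ => g (-Real.log 1) * (((1:ℝ) ^ (-(1 / 2 : ℝ)) : ℝ) : ℂ)) s) *
        ((|s - 1|⁻¹ : ℝ) : ℂ)) (Ioi 0) := by
  set h : ℝ → ℂ := fun s => g (-Real.log s) * ((s ^ (-(1 / 2 : ℝ)) : ℝ) : ℂ) with hh_def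
  set ind : ℝ → ℂ := (Iic (2:ℝ)).indicator (fun _ => h 1) with hind
  change IntegrableOn (fun s => (h s - ind s) * ((|s - 1|⁻¹ : ℝ) : ℂ)) (Ioi 0)
  have hh : IntegrableOn h (Ioi 0) := integrableOn_weight hg
  have hind_int : IntegrableOn ind (Ioi 0) := by
    rw [hind, IntegrableOn, integrable_indicator_iff measurableSet_Iic]
    refine integrableOn_const ?_
    rw [Measure.restrict_apply measurableSet_Iic, Iic_inter_Ioi, Real.volume_Ioc]
    exact ENNReal.ofReal_ne_top
  have hk : IntegrableOn (fun s => h s - ind s) (Ioi 0) := hh.sub hind_int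
  have hmeas : Measurable fun s : ℝ => ((|s - 1|⁻¹ : ℝ) : ℂ) :=
    Complex.measurable_ofReal.comp (by fun_prop)
  -- away from `s = 1`: the factor is bounded by `2`
  have hfar : ∀ t : Set ℝ, t ⊆ Ioi 0 → (∀ s ∈ t, (1/2 : ℝ) ≤ |s - 1|) → MeasurableSet t →
      IntegrableOn (fun s => (h s - ind s) * ((|s - 1|⁻¹ : ℝ) : ℂ)) t := by
    intro t ht hfar hmt
    have h1 : IntegrableOn (fun s => h s - ind s) t := hk.mono_set ht
    have h2 : ∀ᵐ s ∂(volume.restrict t), ‖((|s - 1|⁻¹ : ℝ) : ℂ)‖ ≤ 2 := by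
      refine (ae_restrict_mem hmt).mono fun s hs => ?_
      rw [Complex.norm_real, Real.norm_eq_abs, abs_of_nonneg (by positivity)]
      have := hfar s hs
      calc |s - 1|⁻¹ ≤ (1/2 : ℝ)⁻¹ := by
            exact inv_anti₀ (by norm_num) this
        _ = 2 := by norm_num
    have := h1.bdd_mul hmeas.aestronglyMeasurable h2
    rw [IntegrableOn]
    simpa only [mul_comm] using this
  -- near `s = 1`: Lipschitz bound
  have hnear : IntegrableOn (fun s => (h s - ind s) * ((|s - 1|⁻¹ : ℝ) : ℂ)) (Icc (1/2 : ℝ) (3/2)) := by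
    have hK : Icc (1/2 : ℝ) (3/2) ⊆ Ioi 0 := fun s hs => lt_of_lt_of_le (by norm_num) hs.1
    have hcd := contDiffOn_weight hg
    have hderiv : ContinuousOn (deriv h) (Ioi 0) := hcd.continuousOn_deriv_of_isOpen isOpen_Ioi le_rfl
    obtain ⟨M, hM⟩ := isCompact_Icc.exists_bound_of_continuousOn (hderiv.mono hK)
    have hdiff : ∀ x ∈ Icc (1/2 : ℝ) (3/2), DifferentiableAt ℝ h x := fun x hx =>
      (hcd.differentiableOn one_ne_zero).differentiableAt (Ioi_mem_nhds (hK hx))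
    have hlip : ∀ s ∈ Icc (1/2 : ℝ) (3/2), ‖h s - h 1‖ ≤ M * ‖s - 1‖ := fun s hs =>
      (convex_Icc _ _).norm_image_sub_le_of_norm_deriv_le hdiff hM (by norm_num) hs
    refine Measure.integrableOn_of_bounded (M := max M 0) (by rw [Real.volume_Icc]; exact ENNReal.ofReal_ne_top)
      ?_ ?_
    · have hmh : Measurable h :=
        (hg.1.continuous.measurable.comp Real.measurable_log.neg).mul
          (Complex.measurable_ofReal.comp (measurable_id.pow_const _))
      have hmi : Measurable ind := by
        rw [hind]; exact measurable_const.indicator measurableSet_Iic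
      exact ((hmh.sub hmi).mul hmeas).aestronglyMeasurable
    · refine (ae_restrict_mem measurableSet_Icc).mono fun s hs => ?_
      have hs2 : s ∈ Iic (2:ℝ) := by simp only [mem_Iic]; linarith [hs.2]
      rw [hind, indicator_of_mem hs2, norm_mul, Complex.norm_real, Real.norm_eq_abs,
        abs_of_nonneg (by positivity : (0:ℝ) ≤ |s - 1|⁻¹)]
      rcases eq_or_ne s 1 with rfl | hs1
      · simp
      · have hpos : 0 < |s - 1| := abs_pos.2 (sub_ne_zero.2 hs1)
        have := hlip s hs
        rw [Real.norm_eq_abs] at this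
        calc ‖h s - h 1‖ * |s - 1|⁻¹ ≤ M * |s - 1| * |s - 1|⁻¹ := by gcongr
          _ = M := by field_simp
          _ ≤ max M 0 := le_max_left _ _
  -- glue
  have hcover : Ioi (0:ℝ) = (Ioc 0 (1/2) ∪ Ici (3/2)) ∪ Icc (1/2) (3/2) := by
    ext s; simp only [mem_Ioi, mem_union, mem_Ioc, mem_Ici, mem_Icc]
    constructor
    · intro hs
      by_cases h1 : s ≤ 1/2
      · exact Or.inl (Or.inl ⟨hs, h1⟩)
      · by_cases h2 : 3/2 ≤ s
        · exact Or.inl (Or.inr h2)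
        · exact Or.inr ⟨by linarith, by linarith⟩
    · rintro ((⟨h1, -⟩ | h1) | ⟨h1, -⟩) <;> linarith
  rw [hcover]
  refine IntegrableOn.union (IntegrableOn.union ?_ ?_) hnear
  · exact hfar _ (fun s hs => hs.1) (fun s hs => by rw [abs_of_nonpos (by linarith [hs.2])]; linarith [hs.2])
      measurableSet_Ioc
  · exact hfar _ (fun s hs => lt_of_lt_of_le (by norm_num) (mem_Ici.1 hs))
      (fun s hs => by rw [abs_of_nonneg (by linarith [mem_Ici.1 hs])]; linarith [mem_Ici.1 hs])
      measurableSet_Ici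

/-! ## Part F. The archimedean trace formula with the constant in closed (real-variable) form -/

/-- **Connes 1999 Thm V.3 (`K = ℝ`, even part) with explicit constant**: for every test function `g` and
every Hilbert basis `b` of `L²(ℝ)_ev`,
`Σ_i ⟪b_i, ϑ(f)𝔽P_Λ𝔽⁻¹P_Λ b_i⟫ − (2 g(0) log Λ + C(g)) → 0` (`Λ → ∞`) with
`C(g) = ∫₀^∞ h/(2(s+1)) + ∫₀^∞ (h(s) − h(1)1_{s≤2})/(2|s−1|) + h(1)(log 2π + γ)`, `h(s) = g(−log s)s^{−1/2}`
(`h(1) = g(0)`).  Part D below identifies `C(g)` with Connes' principal value `∫′_ℝ = connesArchPV g`.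
[cite: Connes1999, §V Thm 3 (K = ℝ); Connes2026Letter, §7.1 (arXiv p0024:L24); ConnesConsani2021, §1 Prop. 1.5 (ii)–(iii)] -/
theorem tendsto_tsum_diagCoeff_cutoff_sub_explicit {g : ℝ → ℂ} (hg : IsWeilTest g)
    {ι : Type*} (b : HilbertBasis ι ℂ evenPart) :
    Tendsto (fun Λ : ℝ =>
        (∑' i, diagCoeff g (fourierL2 * cutoffProj Λ * fourierL2Inv * cutoffProj Λ)
            ((b i : evenPart) : Lp ℂ 2 (volume : Measure ℝ)))
          - (2 * (Real.log Λ : ℂ) * g 0 +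
            ((∫ s in Ioi (0 : ℝ), g (-Real.log s) * ((s ^ (-(1 / 2 : ℝ)) : ℝ) : ℂ) *
                ((1 / (2 * (s + 1)) : ℝ) : ℂ)) +
              (∫ s in Ioi (0 : ℝ), (g (-Real.log s) * ((s ^ (-(1 / 2 : ℝ)) : ℝ) : ℂ) -
                (Iic (2:ℝ)).indicator (fun _ => g 0) s) * (((2 * |s - 1|)⁻¹ : ℝ) : ℂ)) +
              g 0 * ((Real.log (2 * π) + Real.eulerMascheroniConstant : ℝ) : ℂ))))
      atTop (𝓝 0) := by
  have h1 : g (-Real.log 1) * (((1:ℝ) ^ (-(1 / 2 : ℝ)) : ℝ) : ℂ) = g 0 := by simp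
  have hC4 := tendsto_integral_sinIntegral_kernels_sub_log (integrableOn_weight hg)
    (integrableOn_weight_sub_div hg)
  rw [h1] at hC4
  set C : ℂ := (∫ s in Ioi (0 : ℝ), g (-Real.log s) * ((s ^ (-(1 / 2 : ℝ)) : ℝ) : ℂ) *
      ((1 / (2 * (s + 1)) : ℝ) : ℂ)) +
      (∫ s in Ioi (0 : ℝ), (g (-Real.log s) * ((s ^ (-(1 / 2 : ℝ)) : ℝ) : ℂ) -
        (Iic (2:ℝ)).indicator (fun _ => g 0) s) * (((2 * |s - 1|)⁻¹ : ℝ) : ℂ)) +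
      g 0 * ((Real.log (2 * π) + Real.eulerMascheroniConstant : ℝ) : ℂ) with hC
  have h2 := (hC4.comp (tendsto_pow_atTop two_ne_zero)).sub_const C
  rw [sub_self] at h2
  refine h2.congr' ?_
  filter_upwards [eventually_gt_atTop 0] with Λ hΛ
  simp only [Function.comp_apply]
  rw [tsum_diagCoeff_cutoff_eq_integral_sinIntegral hg hΛ b, Real.log_pow, Nat.cast_ofNat]
  push_cast
  ring

/-! ## Part D. The constant is Connes' principal value `∫′_ℝ = connesArchPV g` (App. II (36)) -/

section PartD

variable {g : ℝ → ℂ}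

/-- `t^{1/2}/t = t^{−1/2}` for `t > 0`. [folklore] -/
private theorem rpow_half_div_self {t : ℝ} (ht : 0 < t) : t ^ (1 / 2 : ℝ) / t = t ^ (-(1 / 2 : ℝ)) := by
  have := Real.rpow_sub ht (1 / 2 : ℝ) 1
  rw [Real.rpow_one] at this
  rw [← this]; norm_num

/-- On `u > 0` the integrand of App. II (36) is `h(u)/(2|1−u|)`, `h(u) = g(−log u) u^{−1/2}`. [cite: Connes1999, App. II (36)] -/
private theorem archIntegrand_of_pos (g : ℝ → ℂ) {u : ℝ} (hu : 0 < u) :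
    (((|u| ^ (1 / 2 : ℝ)) / |1 - u| / (2 * |u|) : ℝ) : ℂ) * g (-Real.log |u|) =
      (g (-Real.log u) * ((u ^ (-(1 / 2 : ℝ)) : ℝ) : ℂ)) * (((2 * |u - 1|)⁻¹ : ℝ) : ℂ) := by
  rw [abs_of_pos hu, abs_sub_comm, mul_comm (g _)]
  rw [mul_assoc, mul_comm (g _), ← mul_assoc, ← Complex.ofReal_mul]
  congr 2
  rw [← rpow_half_div_self hu]
  field_simp

/-- On `t > 0`, the reflected integrand: `K(−t) = h(t)/(2(t+1))`. [cite: Connes1999, App. II (36)] -/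
private theorem archIntegrand_neg_of_pos (g : ℝ → ℂ) {t : ℝ} (ht : 0 < t) :
    (((|-t| ^ (1 / 2 : ℝ)) / |1 - -t| / (2 * |-t|) : ℝ) : ℂ) * g (-Real.log |-t|) =
      (g (-Real.log t) * ((t ^ (-(1 / 2 : ℝ)) : ℝ) : ℂ)) * ((1 / (2 * (t + 1)) : ℝ) : ℂ) := by
  rw [abs_neg, abs_of_pos ht, sub_neg_eq_add, abs_of_pos (by linarith : (0:ℝ) < 1 + t), mul_comm (g _)]
  rw [mul_assoc, mul_comm (g _), ← mul_assoc, ← Complex.ofReal_mul]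
  congr 2
  rw [← rpow_half_div_self ht]
  field_simp
  ring

/-- **The negative half-line of App. II (36)**: `∫_{u<0} K = ∫₀^∞ h(t)/(2(t+1)) dt`, with integrability.
[cite: Connes1999, App. II (36)] -/
private theorem archIntegrand_Iio (hg : IsWeilTest g) :
    IntegrableOn (fun u : ℝ => (((|u| ^ (1 / 2 : ℝ)) / |1 - u| / (2 * |u|) : ℝ) : ℂ) * g (-Real.log |u|))
      (Iio 0) ∧
    ∫ u in Iio 0, (((|u| ^ (1 / 2 : ℝ)) / |1 - u| / (2 * |u|) : ℝ) : ℂ) * g (-Real.log |u|) =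
      ∫ t in Ioi (0:ℝ), (g (-Real.log t) * ((t ^ (-(1 / 2 : ℝ)) : ℝ) : ℂ)) * ((1 / (2 * (t + 1)) : ℝ) : ℂ) := by
  set f : ℝ → ℝ := fun t => -t with hf
  have hderiv : ∀ t ∈ Ioi (0:ℝ), HasDerivWithinAt f (-1) (Ioi 0) t := fun t _ =>
    (hasDerivAt_neg t).hasDerivWithinAt
  have hinj : InjOn f (Ioi 0) := fun x _ y _ h => neg_injective h
  have himg : f '' Ioi 0 = Iio 0 := by
    rw [hf]; simp
  have hpt : ∀ t ∈ Ioi (0:ℝ), |(-1:ℝ)| • ((((|f t| ^ (1 / 2 : ℝ)) / |1 - f t| / (2 * |f t|) : ℝ) : ℂ) *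
      g (-Real.log |f t|)) =
      (g (-Real.log t) * ((t ^ (-(1 / 2 : ℝ)) : ℝ) : ℂ)) * ((1 / (2 * (t + 1)) : ℝ) : ℂ) := by
    intro t ht
    rw [abs_neg, abs_one, one_smul]
    exact archIntegrand_neg_of_pos g ht
  -- the right-hand integrand is integrable: `h` integrable, weight bounded by `1/2`
  have hI : IntegrableOn (fun t : ℝ => (g (-Real.log t) * ((t ^ (-(1 / 2 : ℝ)) : ℝ) : ℂ)) *
      ((1 / (2 * (t + 1)) : ℝ) : ℂ)) (Ioi 0) := by
    have h1 := integrableOn_weight hg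
    have h2 : ∀ᵐ t ∂(volume.restrict (Ioi (0:ℝ))), ‖((1 / (2 * (t + 1)) : ℝ) : ℂ)‖ ≤ 1 / 2 := by
      refine (ae_restrict_mem measurableSet_Ioi).mono fun t ht => ?_
      rw [Complex.norm_real, Real.norm_eq_abs, abs_of_pos (by have := mem_Ioi.1 ht; positivity)]
      have := mem_Ioi.1 ht
      exact div_le_div_of_nonneg_left (by norm_num) (by norm_num) (by linarith)
    have := h1.bdd_mul ((Complex.measurable_ofReal.comp (by fun_prop)).aestronglyMeasurable) h2
    rw [IntegrableOn]
    refine this.congr (Eventually.of_forall fun t => ?_)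
    simp only [Function.comp_apply]
    ring
  refine ⟨?_, ?_⟩
  · rw [← himg, integrableOn_image_iff_integrableOn_abs_deriv_smul measurableSet_Ioi hderiv hinj]
    exact (integrableOn_congr_fun hpt measurableSet_Ioi).2 hI
  · rw [← himg, integral_image_eq_integral_abs_deriv_smul measurableSet_Ioi hderiv hinj]
    exact setIntegral_congr_fun measurableSet_Ioi hpt

/-- `∫_ε^1 dv/(2v) = −(log ε)/2` for `0 < ε`. [folklore] -/
private theorem integral_inv_two_mul {ε : ℝ} (hε : 0 < ε) :
    ∫ v in ε..1, (2 * v)⁻¹ = -(Real.log ε) / 2 := by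
  have h1 : (fun v : ℝ => (2 * v)⁻¹) = fun v => 2⁻¹ * v⁻¹ := by funext v; rw [mul_inv]
  rw [h1, intervalIntegral.integral_const_mul, integral_inv (Set.notMem_uIcc_of_lt hε zero_lt_one),
    one_div, Real.log_inv]
  ring

/-- Counterterm, left piece: `∫_{(0,1−ε]} du/(2|u−1|) = −(log ε)/2` (`0 < ε < 1`). [folklore] -/
private theorem integral_counterweight_left {ε : ℝ} (hε : 0 < ε) (hε1 : ε < 1) :
    ∫ u in Ioc (0:ℝ) (1 - ε), (((2 * |u - 1|)⁻¹ : ℝ) : ℂ) = ((-(Real.log ε) / 2 : ℝ) : ℂ) := by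
  rw [← intervalIntegral.integral_of_le (by linarith : (0:ℝ) ≤ 1 - ε), intervalIntegral.integral_ofReal]
  congr 1
  have h1 : ∀ u ∈ Set.uIcc (0:ℝ) (1 - ε), (2 * |u - 1|)⁻¹ = (fun v : ℝ => (2 * v)⁻¹) (1 - u) := by
    intro u hu
    rw [Set.uIcc_of_le (by linarith : (0:ℝ) ≤ 1 - ε)] at hu
    simp only
    rw [abs_of_nonpos (by linarith [hu.2]), neg_sub]
  rw [intervalIntegral.integral_congr h1, intervalIntegral.integral_comp_sub_left (fun v : ℝ => (2 * v)⁻¹) 1,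
    show (1:ℝ) - (1 - ε) = ε by ring, sub_zero]
  exact integral_inv_two_mul hε

/-- Counterterm, right piece: `∫_{[1+ε,2]} du/(2|u−1|) = −(log ε)/2` (`0 < ε < 1`). [folklore] -/
private theorem integral_counterweight_right {ε : ℝ} (hε : 0 < ε) (hε1 : ε < 1) :
    ∫ u in Icc (1 + ε) (2:ℝ), (((2 * |u - 1|)⁻¹ : ℝ) : ℂ) = ((-(Real.log ε) / 2 : ℝ) : ℂ) := by
  rw [integral_Icc_eq_integral_Ioc, ← intervalIntegral.integral_of_le (by linarith : 1 + ε ≤ (2:ℝ)),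
    intervalIntegral.integral_ofReal]
  congr 1
  have h1 : ∀ u ∈ Set.uIcc (1 + ε) (2:ℝ), (2 * |u - 1|)⁻¹ = (fun v : ℝ => (2 * v)⁻¹) (u - 1) := by
    intro u hu
    rw [Set.uIcc_of_le (by linarith : 1 + ε ≤ (2:ℝ))] at hu
    simp only
    rw [abs_of_nonneg (by linarith [hu.1])]
  rw [intervalIntegral.integral_congr h1, intervalIntegral.integral_comp_sub_right (fun v : ℝ => (2 * v)⁻¹) 1,
    show (1:ℝ) + ε - 1 = ε by ring, show (2:ℝ) - 1 = 1 by norm_num]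
  exact integral_inv_two_mul hε

/-- The weight `(2|u−1|)⁻¹` is bounded by `(2ε)⁻¹` where `ε ≤ |u−1|`. [folklore] -/
private theorem norm_weight_le {ε u : ℝ} (hε : 0 < ε) (hu : ε ≤ |u - 1|) :
    ‖(((2 * |u - 1|)⁻¹ : ℝ) : ℂ)‖ ≤ (2 * ε)⁻¹ := by
  rw [Complex.norm_real, Real.norm_eq_abs, abs_of_nonneg (by positivity)]
  exact inv_anti₀ (by positivity) (by linarith)

/-- `h·(2|u−1|)⁻¹` is integrable on any measurable `T ⊆ (0,∞) ∩ {ε ≤ |u−1|}`. [folklore] -/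
private theorem integrableOn_weight_mul_of_subset (hg : IsWeilTest g) {ε : ℝ} (hε : 0 < ε) {T : Set ℝ}
    (hT : MeasurableSet T) (hT0 : T ⊆ Ioi 0) (hTε : ∀ u ∈ T, ε ≤ |u - 1|) :
    IntegrableOn (fun u : ℝ => (g (-Real.log u) * ((u ^ (-(1 / 2 : ℝ)) : ℝ) : ℂ)) *
      (((2 * |u - 1|)⁻¹ : ℝ) : ℂ)) T := by
  have h1 := (integrableOn_weight hg).mono_set hT0
  have h2 : ∀ᵐ u ∂(volume.restrict T), ‖(((2 * |u - 1|)⁻¹ : ℝ) : ℂ)‖ ≤ (2 * ε)⁻¹ :=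
    (ae_restrict_mem hT).mono fun u hu => norm_weight_le hε (hTε u hu)
  have := h1.bdd_mul ((Complex.measurable_ofReal.comp (by fun_prop)).aestronglyMeasurable) h2
  rw [IntegrableOn]
  exact this.congr (Eventually.of_forall fun u => by simp only [Function.comp_apply]; ring)

/-- The regular part `(h − g(0)1_{(−∞,2]})·(2|u−1|)⁻¹` is integrable on `(0,∞)` ((H2), halved). [folklore] -/
private theorem integrableOn_sub_ind_weight (hg : IsWeilTest g) :
    IntegrableOn (fun u : ℝ => (g (-Real.log u) * ((u ^ (-(1 / 2 : ℝ)) : ℝ) : ℂ) -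
      (Iic (2:ℝ)).indicator (fun _ => g 0) u) * (((2 * |u - 1|)⁻¹ : ℝ) : ℂ)) (Ioi 0) := by
  have h1 : g (-Real.log 1) * (((1:ℝ) ^ (-(1 / 2 : ℝ)) : ℝ) : ℂ) = g 0 := by simp
  have h2 : IntegrableOn (fun u : ℝ => (1 / 2 : ℂ) * ((g (-Real.log u) * ((u ^ (-(1 / 2 : ℝ)) : ℝ) : ℂ) -
      (Iic (2:ℝ)).indicator (fun _ => g (-Real.log 1) * (((1:ℝ) ^ (-(1 / 2 : ℝ)) : ℝ) : ℂ)) u) *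
        ((|u - 1|⁻¹ : ℝ) : ℂ))) (Ioi 0) :=
    Integrable.const_mul (integrableOn_weight_sub_div hg) (1 / 2 : ℂ)
  rw [h1] at h2
  refine IntegrableOn.congr_fun h2 (fun u _ => ?_) measurableSet_Ioi
  push_cast
  ring

/-- **App. II (36) for `0 < ε < 1`, in the `u`-variable**:
`connesArchTrunc g ε = ∫₀^∞ h/(2(t+1)) + ∫₀^∞ 1_{ε ≤ |u−1|} (h(u) − g(0)1_{u≤2})/(2|u−1|) du`
(the counterterm `g(0)1_{(0,2]}` integrates to exactly `−g(0) log ε`). [cite: Connes1999, App. II (36)] -/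
private theorem connesArchTrunc_eq_indicator (hg : IsWeilTest g) {ε : ℝ} (hε : 0 < ε) (hε1 : ε < 1) :
    connesArchTrunc g ε =
      (∫ t in Ioi (0:ℝ), (g (-Real.log t) * ((t ^ (-(1 / 2 : ℝ)) : ℝ) : ℂ)) * ((1 / (2 * (t + 1)) : ℝ) : ℂ)) +
      ∫ u in Ioi (0:ℝ), (Ioc 0 (1 - ε) ∪ Ici (1 + ε)).indicator
        (fun u => (g (-Real.log u) * ((u ^ (-(1 / 2 : ℝ)) : ℝ) : ℂ) - (Iic (2:ℝ)).indicator (fun _ => g 0) u) *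
          (((2 * |u - 1|)⁻¹ : ℝ) : ℂ)) u := by
  set K : ℝ → ℂ := fun u => (((|u| ^ (1 / 2 : ℝ)) / |1 - u| / (2 * |u|) : ℝ) : ℂ) * g (-Real.log |u|)
    with hK
  set h : ℝ → ℂ := fun u => g (-Real.log u) * ((u ^ (-(1 / 2 : ℝ)) : ℝ) : ℂ) with hh_def
  set w : ℝ → ℂ := fun u => (((2 * |u - 1|)⁻¹ : ℝ) : ℂ) with hw
  set ind : ℝ → ℂ := (Iic (2:ℝ)).indicator (fun _ => g 0) with hind
  set T : Set ℝ := Ioc 0 (1 - ε) ∪ Ici (1 + ε) with hTdef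
  have hTm : MeasurableSet T := measurableSet_Ioc.union measurableSet_Ici
  have hT0 : T ⊆ Ioi 0 := by
    rintro u (hu | hu)
    · exact hu.1
    · exact lt_of_lt_of_le (by linarith) (mem_Ici.1 hu)
  have hTε : ∀ u ∈ T, ε ≤ |u - 1| := by
    rintro u (hu | hu)
    · rw [abs_of_nonpos (by linarith [hu.2])]; linarith [hu.2]
    · rw [abs_of_nonneg (by linarith [mem_Ici.1 hu])]; linarith [mem_Ici.1 hu]
  -- `K = h w` on `u > 0`
  have hKpos : ∀ u ∈ Ioi (0:ℝ), K u = h u * w u := fun u hu => archIntegrand_of_pos g hu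
  -- integrability of the pieces
  obtain ⟨hKIio, hKIio_val⟩ := archIntegrand_Iio hg
  have hhwT : IntegrableOn (fun u => h u * w u) T := integrableOn_weight_mul_of_subset hg hε hTm hT0 hTε
  have hKT : IntegrableOn K T := hhwT.congr_fun (fun u hu => (hKpos u (hT0 hu)).symm) hTm
  have hK1 : IntegrableOn K (Ioc 0 (1 - ε)) := hKT.mono_set subset_union_left
  have hK2 : IntegrableOn K (Ici (1 + ε)) := hKT.mono_set subset_union_right
  have hKIic : IntegrableOn K (Iic 0) := hKIio.congr_set_ae Iio_ae_eq_Iic.symm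
  -- the domain of (36)
  have hS : {u : ℝ | ε ≤ |1 - u|} = Iic (1 - ε) ∪ Ici (1 + ε) := by
    ext u
    simp only [mem_setOf_eq, mem_union, mem_Iic, mem_Ici]
    rw [le_abs']
    constructor
    · rintro (h | h)
      · right; linarith
      · left; linarith
    · rintro (h | h)
      · right; linarith
      · left; linarith
  have hdisj1 : Disjoint (Iic (1 - ε)) (Ici (1 + ε)) :=
    disjoint_left.2 fun u (hu : u ≤ 1 - ε) (hu' : 1 + ε ≤ u) => by linarith
  have hdisj2 : Disjoint (Iic (0 : ℝ)) (Ioc 0 (1 - ε)) :=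
    disjoint_left.2 fun u (hu : u ≤ 0) hu' => by linarith [hu'.1]
  have hdisj3 : Disjoint (Ioc (0:ℝ) (1 - ε)) (Ici (1 + ε)) :=
    disjoint_left.2 fun u hu (hu' : 1 + ε ≤ u) => by linarith [hu.2]
  have hKAB : IntegrableOn K (Iic (1 - ε)) := by
    rw [← Iic_union_Ioc_eq_Iic (by linarith : (0:ℝ) ≤ 1 - ε)]; exact hKIic.union hK1
  have hint : ∫ u in {u : ℝ | ε ≤ |1 - u|}, K u =
      (∫ u in Iio 0, K u) + ((∫ u in Ioc 0 (1 - ε), K u) + ∫ u in Ici (1 + ε), K u) := by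
    rw [hS, setIntegral_union hdisj1 measurableSet_Ici hKAB hK2,
      ← Iic_union_Ioc_eq_Iic (by linarith : (0:ℝ) ≤ 1 - ε),
      setIntegral_union hdisj2 measurableSet_Ioc hKIic hK1, integral_Iic_eq_integral_Iio, add_assoc]
  -- the positive part as one integral over `T` of `h w`
  have hpos : (∫ u in Ioc 0 (1 - ε), K u) + (∫ u in Ici (1 + ε), K u) = ∫ u in T, h u * w u := by
    rw [hTdef, setIntegral_union hdisj3 measurableSet_Ici (hhwT.mono_set subset_union_left)
      (hhwT.mono_set subset_union_right)]
    congr 1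
    · exact setIntegral_congr_fun measurableSet_Ioc fun u hu => hKpos u hu.1
    · exact setIntegral_congr_fun measurableSet_Ici fun u hu =>
        hKpos u (lt_of_lt_of_le (by linarith) (mem_Ici.1 hu))
  -- the weight alone on the two bounded pieces
  have hwm : Measurable w := Complex.measurable_ofReal.comp (by fun_prop)
  have hwint : ∀ {S : Set ℝ}, MeasurableSet S → volume S < ⊤ → (∀ u ∈ S, ε ≤ |u - 1|) →
      IntegrableOn w S := by
    intro S hS hSfin hSε
    exact Measure.integrableOn_of_bounded hSfin.ne hwm.aestronglyMeasurable
      ((ae_restrict_mem hS).mono fun u hu => norm_weight_le hε (hSε u hu))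
  have hw1 : IntegrableOn w (Ioc 0 (1 - ε)) :=
    hwint measurableSet_Ioc measure_Ioc_lt_top fun u hu => hTε u (Or.inl hu)
  have hw2 : IntegrableOn w (Icc (1 + ε) 2) :=
    hwint measurableSet_Icc measure_Icc_lt_top fun u hu => hTε u (Or.inr (mem_Ici.2 hu.1))
  -- split `h w = (h − ind) w + ind w` on `T`
  have hF : IntegrableOn (fun u => (h u - ind u) * w u) T := (integrableOn_sub_ind_weight hg).mono_set hT0
  have hindw : IntegrableOn (fun u => ind u * w u) T :=
    (hhwT.sub hF).congr_fun (fun u _ => by simp only [Pi.sub_apply]; ring) hTm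
  have hsplit : ∫ u in T, h u * w u = (∫ u in T, (h u - ind u) * w u) + ∫ u in T, ind u * w u := by
    rw [← integral_add hF hindw]
    exact integral_congr_ae (Eventually.of_forall fun u => by simp only; ring)
  -- the counterterm
  have hT2 : T ∩ Iic 2 = Ioc 0 (1 - ε) ∪ Icc (1 + ε) 2 := by
    ext u
    simp only [hTdef, mem_inter_iff, mem_union, mem_Ioc, mem_Ici, mem_Iic, mem_Icc]
    constructor
    · rintro ⟨h | h, h2⟩
      · exact Or.inl h
      · exact Or.inr ⟨h, h2⟩
    · rintro (h | h)
      · exact ⟨Or.inl h, by linarith [h.2]⟩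
      · exact ⟨Or.inr h.1, h.2⟩
  have hdisj4 : Disjoint (Ioc (0:ℝ) (1 - ε)) (Icc (1 + ε) 2) :=
    disjoint_left.2 fun u hu hu' => by linarith [hu.2, hu'.1]
  have hcount : ∫ u in T, ind u * w u = -(Real.log ε : ℂ) * g 0 := by
    have e1 : (fun u => ind u * w u) = (Iic (2:ℝ)).indicator (fun u => g 0 * w u) := by
      funext u
      by_cases hu : u ∈ Iic (2:ℝ)
      · simp [hind, hu]
      · simp [hind, hu]
    rw [e1, setIntegral_indicator measurableSet_Iic, hT2, integral_const_mul,
      setIntegral_union hdisj4 measurableSet_Icc hw1 hw2, hw, integral_counterweight_left hε hε1,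
      integral_counterweight_right hε hε1]
    push_cast; ring
  -- assemble
  have hind_int : ∫ u in T, (h u - ind u) * w u = ∫ u in Ioi (0:ℝ), T.indicator (fun u => (h u - ind u) * w u) u := by
    rw [setIntegral_indicator hTm, inter_eq_right.2 hT0]
  unfold connesArchTrunc
  rw [show (∫ u in {u : ℝ | ε ≤ |1 - u|}, (((|u| ^ (1 / 2 : ℝ)) / |1 - u| / (2 * |u|) : ℝ) : ℂ) *
      g (-Real.log |u|)) = ∫ u in {u : ℝ | ε ≤ |1 - u|}, K u from rfl, hint, hKIio_val, hpos, hsplit,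
    hcount, hind_int]
  ring

/-- The `ε → 0⁺` limit of the indicator-truncated regular part is the full integral (dominated
convergence; the integrand is integrable by (H2)). [folklore] -/
private theorem tendsto_integral_indicator_sub_ind_weight (hg : IsWeilTest g) :
    Tendsto (fun ε : ℝ => ∫ u in Ioi (0:ℝ), (Ioc 0 (1 - ε) ∪ Ici (1 + ε)).indicator
        (fun u => (g (-Real.log u) * ((u ^ (-(1 / 2 : ℝ)) : ℝ) : ℂ) - (Iic (2:ℝ)).indicator (fun _ => g 0) u) *
          (((2 * |u - 1|)⁻¹ : ℝ) : ℂ)) u)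
      (𝓝[>] 0)
      (𝓝 (∫ u in Ioi (0:ℝ), (g (-Real.log u) * ((u ^ (-(1 / 2 : ℝ)) : ℝ) : ℂ) -
        (Iic (2:ℝ)).indicator (fun _ => g 0) u) * (((2 * |u - 1|)⁻¹ : ℝ) : ℂ))) := by
  set F : ℝ → ℂ := fun u => (g (-Real.log u) * ((u ^ (-(1 / 2 : ℝ)) : ℝ) : ℂ) -
    (Iic (2:ℝ)).indicator (fun _ => g 0) u) * (((2 * |u - 1|)⁻¹ : ℝ) : ℂ) with hFdef
  have hF : IntegrableOn F (Ioi 0) := integrableOn_sub_ind_weight hg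
  refine tendsto_integral_filter_of_dominated_convergence (fun u => ‖F u‖) ?_ ?_ hF.norm ?_
  · exact Eventually.of_forall fun ε =>
      hF.aestronglyMeasurable.indicator (measurableSet_Ioc.union measurableSet_Ici)
  · exact Eventually.of_forall fun ε => Eventually.of_forall fun u => norm_indicator_le_norm_self _ _
  · have hae : ∀ᵐ u : ℝ, u ≠ 1 := by
      have : ({1}ᶜ : Set ℝ) ∈ ae (volume : Measure ℝ) := compl_mem_ae_iff.2 (measure_singleton _)
      filter_upwards [this] with u hu
      simpa using hu
    filter_upwards [ae_restrict_mem measurableSet_Ioi, ae_restrict_of_ae hae] with u hu0 hu1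
    refine tendsto_const_nhds.congr' ?_
    have hpos : 0 < |u - 1| := abs_pos.2 (sub_ne_zero.2 hu1)
    filter_upwards [Ioo_mem_nhdsGT hpos] with ε hε
    have hmem : u ∈ Ioc 0 (1 - ε) ∪ Ici (1 + ε) := by
      rcases lt_or_gt_of_ne hu1 with h | h
      · left
        rw [abs_of_neg (by linarith)] at hε
        exact ⟨hu0, by linarith [hε.2]⟩
      · right
        rw [abs_of_pos (by linarith)] at hε
        exact mem_Ici.2 (by linarith [hε.2])
    exact (indicator_of_mem hmem F).symm

/-- **The limit in App. II (36) exists and is explicit**: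
`lim_{ε→0⁺} connesArchTrunc g ε = ∫₀^∞ h/(2(t+1)) dt + ∫₀^∞ (h(s) − g(0)1_{s≤2})/(2|s−1|) ds`,
`h(s) = g(−log s)s^{-1/2}`. [cite: Connes1999, App. II (36)] -/
theorem tendsto_connesArchTrunc_explicit {g : ℝ → ℂ} (hg : IsWeilTest g) :
    Tendsto (connesArchTrunc g) (𝓝[>] 0)
      (𝓝 ((∫ s in Ioi (0 : ℝ), g (-Real.log s) * ((s ^ (-(1 / 2 : ℝ)) : ℝ) : ℂ) *
            ((1 / (2 * (s + 1)) : ℝ) : ℂ)) +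
          ∫ s in Ioi (0 : ℝ), (g (-Real.log s) * ((s ^ (-(1 / 2 : ℝ)) : ℝ) : ℂ) -
            (Iic (2:ℝ)).indicator (fun _ => g 0) s) * (((2 * |s - 1|)⁻¹ : ℝ) : ℂ))) := by
  refine (tendsto_const_nhds.add (tendsto_integral_indicator_sub_ind_weight hg)).congr' ?_
  filter_upwards [Ioo_mem_nhdsGT (zero_lt_one' ℝ)] with ε hε
  exact (connesArchTrunc_eq_indicator hg hε.1 hε.2).symm

/-- **Connes' archimedean principal value in closed real-variable form**:
`connesArchPV g = ∫₀^∞ h/(2(t+1)) + ∫₀^∞ (h(s) − g(0)1_{s≤2})/(2|s−1|) + (log 2π + γ) g(0)`.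
[cite: Connes1999, App. II (36)–(37)] -/
theorem connesArchPV_eq_explicit {g : ℝ → ℂ} (hg : IsWeilTest g) :
    connesArchPV g =
      (∫ s in Ioi (0 : ℝ), g (-Real.log s) * ((s ^ (-(1 / 2 : ℝ)) : ℝ) : ℂ) *
          ((1 / (2 * (s + 1)) : ℝ) : ℂ)) +
        (∫ s in Ioi (0 : ℝ), (g (-Real.log s) * ((s ^ (-(1 / 2 : ℝ)) : ℝ) : ℂ) -
          (Iic (2:ℝ)).indicator (fun _ => g 0) s) * (((2 * |s - 1|)⁻¹ : ℝ) : ℂ)) +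
        g 0 * ((Real.log (2 * π) + Real.eulerMascheroniConstant : ℝ) : ℂ) := by
  rw [connesArchPV, (tendsto_connesArchTrunc_explicit hg).limUnder_eq]
  push_cast
  ring

end PartD

/-! ## Part G. Connes 1999 Thm V.3 = Thm VII.4 at `S = {∞}` (Letter §7.1), hypothesis-free -/

/-- **Connes 1999, Theorem V.3 (= Theorem VII.4 for `k = ℚ`, `S = {∞}`; Letter §7.1 (7.2)), PROVED**:
for every Weil test function `g` and every Hilbert basis of the even part of `L²(ℝ)`, the cutoff trace
`Tr(ϑ_a(g) P̂_Λ P_Λ)` restricted to even functions is (weakly) summable for every `Λ > 0` and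
`Tr_ev(ϑ_a(g) P̂_Λ P_Λ) − (2 log Λ · g(0) + ∫′_ℝ |u|^{1/2} g(−log|u|)/|1−u| d*u) → 0` as `Λ → ∞`,
with Connes' principal value `connesArchPV` (App. II (36), `λ = log 2π + γ`). This is exactly the
conclusion of `Connes1999_thm_VII_4_rat.archimedean`, now without the hypothesis
`Connes1999_thm_VII_4_rat` (whose `P ≠ ∅` cases remain a named fact). Assembled from the weak
nuclear expansion (`ArchimedeanCutoffTraceKernel`), the sine-integral asymptotics (Parts A–F) and the
identification of the constant (Part D).
[cite: Connes1999, §V Thm 3 and §VII Thm 4; Connes2026Letter, §7.1] -/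
theorem Connes1999_thm_VII_4_rat_archimedean {g : ℝ → ℂ} (hg : IsWeilTest g)
    {ι : Type*} (b : HilbertBasis ι ℂ evenPart) :
    (∀ Λ : ℝ, 0 < Λ → Summable fun i => diagCoeff g (fourierL2 * cutoffProj Λ * fourierL2Inv * cutoffProj Λ)
        ((b i : evenPart) : Lp ℂ 2 (volume : Measure ℝ))) ∧
    Tendsto (fun Λ : ℝ =>
        (∑' i, diagCoeff g (fourierL2 * cutoffProj Λ * fourierL2Inv * cutoffProj Λ)
            ((b i : evenPart) : Lp ℂ 2 (volume : Measure ℝ)))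
          - (2 * (Real.log Λ : ℂ) * g 0 + connesArchPV g))
      atTop (𝓝 0) := by
  refine ⟨fun Λ hΛ => summable_diagCoeff_cutoff hg hΛ b, ?_⟩
  rw [connesArchPV_eq_explicit hg]
  exact tendsto_tsum_diagCoeff_cutoff_sub_explicit hg b


/-- **The same in the Letter's normalisation `∫′_ℝ = −W_ℝ`** (Letter §7.1 / §7.4 display: the archimedean
local term enters as `−W_∞(f)`; the tree PROVES `connesArchPV g = −weilArchTerm g`,
`ConnesConsani.connesArchPV_eq_neg_weilArchTerm`): for every Weil test function `g` and every Hilbert basis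
of `L²(ℝ)_ev`, `Tr_ev(ϑ(g) P̂_Λ P_Λ) − (2 log Λ · g(0) − W_ℝ(g)) → 0` as `Λ → ∞`, `W_ℝ = weilArchTerm`.
[cite: Connes2026Letter, §7.1 (arXiv p0024:L24) and §7.4 display (arXiv p0025:L16); Connes1999, App. II (36)–(37)] -/
theorem Connes1999_thm_VII_4_rat_archimedean_weilArchTerm {g : ℝ → ℂ} (hg : IsWeilTest g)
    {ι : Type*} (b : HilbertBasis ι ℂ evenPart) :
    Tendsto (fun Λ : ℝ =>
        (∑' i, diagCoeff g (fourierL2 * cutoffProj Λ * fourierL2Inv * cutoffProj Λ)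
            ((b i : evenPart) : Lp ℂ 2 (volume : Measure ℝ)))
          - (2 * (Real.log Λ : ℂ) * g 0 - weilArchTerm g))
      atTop (𝓝 0) := by
  have h := (Connes1999_thm_VII_4_rat_archimedean hg b).2
  rw [connesArchPV_eq_neg_weilArchTerm hg] at h
  simp only [← sub_eq_add_neg] at h
  exact h

end Literature.NumberTheory.Connes2026






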